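import Summits.ResolutionOfSingularities.ResolutionOfSingularities.Theorems.MarkedTransferCampaignW46CuspStaircasePermissibleRun
import Summits.ResolutionOfSingularities.ResolutionOfSingularities.Theorems.MarkedTransferCampaignW46LiteralCentreProcrastination
import Mathlib.AlgebraicGeometry.FunctionField
import HarnessLib

/-!
# [OURS · L1 W4.6, rung (iii)] The cusp staircase, XIII — SHARPNESS: the length bound `⌊n/p⌋` is ATTAINED
# (cell res-hironaka, LADDER-RESOLUTION rung L, D-0089; slot W4.6, seat res-L1-s46-pv-5 gen 3; host route MarkedTransfer,
# `--kind proof --supports stmt-ResolutionOfSingularities-16155 --as helper`)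

HONEST FRAMING. Everything below is OURS: kernel theorems about the campaign objects of files I–XII of this seat, pv-1's
résumé-free `FinPermissibleRun` (`…FiniteExitBound.lean`) and pv-13's scheme-level state
`(𝔸²_K, E_n = ((y^p + xⁿ)·𝒪, p))` (`…MohWindowCurveInstance.lean`), built with the tree's REAL blow-up library
(`Resolution.exists_isBlowup`, `IsBlowup.isRegular_of_isRegular_subscheme`, `smooth_of_isRegular_of_perfectField`,
`isRegular_subscheme_vanishingIdeal_singleton` — the construction pattern of pv-1's `exists_procrastinatingStep`). NOTHING here
is a statement of H. Hironaka's manuscript *Resolution of singularities in positive characteristics* (2017-03-23,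
[Hironaka2017]) and nothing here asserts that any statement of it holds; the manuscript enters only through the typed
CANDIDATE carriers of row 001 (`AmbientDatum`, `IdealExponent`, `transform`, `IsPermissibleCentre`, `IsStandard`). No
FACT-LIST premise is used. AI review is weaker than expert review. No `sorry`; axioms standard. Def-free (the chain of
blow-ups is built inside the proofs by `Nat.rec` and `Classical.choose`).

## What is proved (every prime `p`, every PERFECT field `K` of characteristic `p`)

File XI (`CuspPlane.finPermissibleRun_len_le`, p502134) bounds the length of every finite §2.1-permissible blow-up sequence
from K4.6's state `(𝔸²_K, E_n)`, `p < n`, `p ∤ n`, by `n/p`. This file shows the bound is attained: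

* `Cusp.exists_pointBlowup` — RÉSUMÉ-FREE STEP EXISTENCE: at a standard state `(A, E)` and a closed singular point `ξ`
  with `{ξ} ≠ Z`, the blow-up of `Z` at `ξ` exists as an ambient datum `A′` over the same (perfect) `K`, `{ξ}` is a
  §2.1-permissible centre, and the transform is standard.
* `Cusp.singleton_ne_univ_of_cuspShape`, `Cusp.mem_sing_of_cuspShape` — a cusp point is not the whole ambient scheme (its
  local ring has dimension `2`, the generic stalk is a field) and is singular when `b ≤ d`.
* `Cusp.exists_successor` — one step of the chain: blowing up a closed cusp point `ξ` of exponents `(b, d)`, `b < d`,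
  yields a standard transform and, when `2b < d`, a CLOSED cusp point of exponents `(b, d − b)` over `ξ`
  (`MohWindow.exists_le_idealOrder_controlledTransform_of_le`, `Cusp.cuspShape_transform_of_le`, `Cusp.isClosed_singleton_of_le`).
* `Cusp.exists_chain` — the whole chain (as ℕ-indexed families with the step laws for as long as the exponent exceeds `b`).
* **`Cusp.exists_finPermissibleRun_of_cuspShape`** — for every standard state with a closed cusp point of exponents `(b, d)`
  and every `L` with `L·b < d`, there is a finite §2.1-permissible sequence of length `L` starting at it.
* **`CuspPlane.exists_finPermissibleRun_len_eq`** — from `(𝔸²_K, E_n)`, `p < n`, `p ∤ n`, there is one of length EXACTLY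
  `n/p`; with `CuspPlane.finPermissibleRun_len_le`: **the maximal length of a §2.1-permissible blow-up sequence from
  K4.6's state is exactly `⌊n/p⌋`** (`CuspPlane.finPermissibleRun_maxLen`) — the length column of the K4.6 table
  (res-L0-k46 j258573; ATLAS-RUN j259568) as a kernel theorem, résumé-free.

Perfectness of `K` is used only to make the (`K`-rational) closed centres smooth over `K` via
`smooth_of_isRegular_of_perfectField`; the upper bound (file XI) holds over every field.

## References

* Seat pv-1 `…LiteralCentreProcrastination.lean` (p469934 ff.), `…FiniteExitBound.lean`; seat pv-13 `…MohWindowCurveInstance.lean`;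
  this seat files I–XII; L/res-L0-k46/KILL-TEST-K4.6.md §4.
* The Stacks Project, Tags 0804, 01TB, 085T (blowing up). [cite: StacksProject, Tag 0804]
* H. Hironaka, ms. 2017-03-23, §2.1 p.4 l.35–39, Def. 2.1 p.5 l.2–3 — scope only, under adjudication, not cited as fact.
  [Hironaka2017]
-/

noncomputable section

set_option linter.dupNamespace false -- mandated namespace of this single-conjunct summit

open CategoryTheory AlgebraicGeometry TopologicalSpace IsLocalRing

namespace Summit.ResolutionOfSingularities.ResolutionOfSingularities.Theorems

namespace CampaignW46

open Literature.AlgebraicGeometry.Resolution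
open Literature.AlgebraicGeometry.Hironaka2017.S02Preliminaries
open Literature.AlgebraicGeometry.Hironaka2017.Datum
open Scheme.IdealSheafData

universe u

namespace Cusp

section Existence

variable {p : ℕ} [Fact p.Prime] {K : Type u} [Field K] [CharP K p]

/-- **A cusp point is not the whole ambient scheme**: if the stalk at `ξ` carries a cusp presentation (so `𝒪_{Z,ξ}` is a
regular local ring of embedding dimension `2`), then `{ξ} ≠ Z` — otherwise `ξ` is the generic point of the integral
scheme `Z`, whose stalk is the function field, with zero maximal ideal. [folklore] -/
theorem singleton_ne_univ_of_cuspShape (A : AmbientDatum p K) {E : IdealExponent A.Z} {ξ : A.Z} {b d : ℕ}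
    (h : CuspShape b d (A.Z.presheaf.stalk ξ) (stalkIdeal E.J ξ)) : ({ξ} : Set A.Z) ≠ Set.univ := by
  intro hU
  haveI := A.irreducible
  haveI : IsIntegral A.Z := ambient_isIntegral A
  have hgen : genericPoint A.Z = ξ := by
    have : genericPoint A.Z ∈ ({ξ} : Set A.Z) := hU ▸ Set.mem_univ _
    exact this
  subst hgen
  obtain ⟨-, hdim, -⟩ := h
  have hF : IsField (A.Z.presheaf.stalk (genericPoint A.Z)) := Field.toIsField A.Z.functionField
  have hbot : maximalIdeal (A.Z.presheaf.stalk (genericPoint A.Z)) = ⊥ :=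
    IsLocalRing.isField_iff_maximalIdeal_eq.mp hF
  rw [hbot, Submodule.spanFinrank_bot] at hdim
  exact absurd hdim (by norm_num)

/-- A point carrying a cusp presentation of exponents `(b, d)` with `b ≤ d` is singular for `E = (J, b)`:
`J_ξ = (y^b + u·x^d) ⊆ 𝔪^b`. [folklore] -/
theorem mem_sing_of_cuspShape {A : AmbientDatum p K} {E : IdealExponent A.Z} {ξ : A.Z} {d : ℕ}
    (h : CuspShape E.b d (A.Z.presheaf.stalk ξ) (stalkIdeal E.J ξ)) (hbd : E.b ≤ d) : ξ ∈ E.sing := by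
  obtain ⟨-, -, x, y, hxy, u, -, hJ⟩ := h
  show (E.b : ℕ∞) ≤ idealOrder E.J ξ
  rw [le_idealOrder_iff, hJ, Ideal.span_singleton_le_iff_mem]
  have hx : x ∈ maximalIdeal _ := hxy ▸ Ideal.subset_span (Set.mem_insert _ _)
  have hy : y ∈ maximalIdeal _ := hxy ▸ Ideal.subset_span (Set.mem_insert_of_mem _ rfl)
  exact add_mem (Ideal.pow_mem_pow hy _)
    (Ideal.mul_mem_left _ _ (Ideal.pow_le_pow_right hbd (Ideal.pow_mem_pow hx _)))

variable [PerfectField K]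

/-- **Résumé-free step existence.** At a standard state `(A, E)` over a PERFECT field and a closed singular point `ξ`
with `{ξ} ≠ Z`: the blow-up of `Z` at `ξ` exists as an ambient datum `A′` over the same `K` (`Resolution.exists_isBlowup`;
regular by `IsBlowup.isRegular_of_isRegular_subscheme`, hence smooth over the perfect `K`; irreducible; proper), the
reduced point `{ξ}` is a §2.1-permissible centre (regular ⇒ smooth over the perfect `K`), and the transform is standard
(`J′ ⊇ J𝒪_{Z′} ≠ 0`). The construction of pv-1's `exists_procrastinatingStep`, without résumé. [folklore] -/
theorem exists_pointBlowup (A : AmbientDatum p K) (E : IdealExponent A.Z) (hE : E.IsStandard) {ξ : A.Z}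
    (hξcl : IsClosed ({ξ} : Set A.Z)) (hξS : ξ ∈ E.sing) (hne : ({ξ} : Set A.Z) ≠ Set.univ) :
    ∃ (A' : AmbientDatum p K) (π : A'.Z ⟶ A.Z), A'.hom = π ≫ A.hom ∧
      IsBlowup π (vanishingIdeal (⟨{ξ}, hξcl⟩ : Closeds A.Z)) ∧ E.IsPermissibleCentre A.hom ⟨{ξ}, hξcl⟩ ∧
      (E.transform π ⟨{ξ}, hξcl⟩).IsStandard := by
  classical
  haveI := A.smooth
  haveI := A.irreducible
  haveI := A.quasiCompact
  haveI : IsLocallyNoetherian A.Z := ambient_isLocallyNoetherian A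
  haveI : IsIntegral A.Z := ambient_isIntegral A
  have hZreg : Scheme.IsRegular A.Z := ambient_isRegular A
  let D : Closeds A.Z := ⟨{ξ}, hξcl⟩
  have hreg : Scheme.IsRegular (vanishingIdeal D).subscheme := isRegular_subscheme_vanishingIdeal_singleton hξcl
  have hcentre : E.IsPermissibleCentre A.hom D :=
    { irreducible := isIrreducible_singleton
      smooth := smooth_of_isRegular_of_perfectField _ hreg
      subset_sing := Set.singleton_subset_iff.2 hξS }
  obtain ⟨Z', π, hπ⟩ := exists_isBlowup A.Z (vanishingIdeal D)
  have hDtop : (vanishingIdeal D).support ≠ ⊤ := by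
    intro h
    apply hne
    have := congrArg (fun S : Closeds A.Z => (S : Set A.Z)) h
    simpa [Scheme.IdealSheafData.coe_support_vanishingIdeal, D] using this
  have hDne : vanishingIdeal D ≠ ⊥ := fun h => hDtop (by rw [h, Scheme.IdealSheafData.support_bot])
  haveI : IsIntegral Z' := hπ.isIntegral hDne
  haveI : IsProper π := hπ.isProper
  have hZ'reg : Scheme.IsRegular Z' := hπ.isRegular_of_isRegular_subscheme hZreg hreg
  haveI : Smooth (π ≫ A.hom) := smooth_of_isRegular_of_perfectField _ hZ'reg
  let A' : AmbientDatum p K :=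
    { Z := Z', hom := π ≫ A.hom, irreducible := inferInstance, smooth := inferInstance,
      quasiCompact := inferInstance }
  haveI : IsLocallyNoetherian A'.Z := ambient_isLocallyNoetherian A'
  refine ⟨A', π, rfl, hπ, hcentre, ?_, hE.2⟩
  intro hbot
  apply hπ.comap_ne_bot hDtop hE.1
  have hle : E.J.comap π ≤ (E.transform π D).J := comap_le_controlledTransform π (vanishingIdeal D) E.J E.b
  rw [hbot] at hle
  exact le_bot_iff.1 hle

/-- **One step of the sharp chain.** Over a perfect field, at a standard state with a CLOSED cusp point `ξ` of exponents
`(b, d)`, `b = E.b`, `1 ≤ b < d`: the blow-up at `ξ` exists as an ambient datum with `{ξ}` permissible and standard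
transform (`exists_pointBlowup`), and if moreover `2b < d` there is a CLOSED point `ξ′` over `ξ` carrying a cusp
presentation of exponents `(b, d − b)` for the transform (`MohWindow.exists_le_idealOrder_controlledTransform_of_le`,
`Cusp.cuspShape_transform_of_le`, `Cusp.isClosed_singleton_of_le`). [folklore] -/
theorem exists_successor (A : AmbientDatum p K) (E : IdealExponent A.Z) (hE : E.IsStandard) {ξ : A.Z}
    (hξcl : IsClosed ({ξ} : Set A.Z)) {d : ℕ} (hbd : E.b < d)
    (hshape : CuspShape E.b d (A.Z.presheaf.stalk ξ) (stalkIdeal E.J ξ)) :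
    ∃ (A' : AmbientDatum p K) (π : A'.Z ⟶ A.Z) (ξ' : A'.Z), A'.hom = π ≫ A.hom ∧
      IsBlowup π (vanishingIdeal (⟨{ξ}, hξcl⟩ : Closeds A.Z)) ∧ E.IsPermissibleCentre A.hom ⟨{ξ}, hξcl⟩ ∧
      (E.transform π ⟨{ξ}, hξcl⟩).IsStandard ∧ IsClosed ({ξ'} : Set A'.Z) ∧
      (2 * E.b < d → CuspShape E.b (d - E.b) (A'.Z.presheaf.stalk ξ')
        (stalkIdeal (E.transform π ⟨{ξ}, hξcl⟩).J ξ')) := by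
  classical
  have hξS : ξ ∈ E.sing := mem_sing_of_cuspShape hshape hbd.le
  obtain ⟨A', π, hhom, hπ, hperm, hstd⟩ :=
    exists_pointBlowup A E hE hξcl hξS (singleton_ne_univ_of_cuspShape A hshape)
  haveI := A.smooth
  haveI := A'.smooth
  haveI : IsLocallyNoetherian A'.Z := ambient_isLocallyNoetherian A'
  haveI : JacobsonSpace A'.Z := ambient_jacobsonSpace A'
  haveI : JacobsonSpace A.Z := ambient_jacobsonSpace A
  haveI : LocallyOfFiniteType π := by
    have h : LocallyOfFiniteType (π ≫ A.hom) := by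
      rw [← hhom]
      infer_instance
    exact locallyOfFiniteType_of_comp π A.hom
  have hY : stalkIdeal (vanishingIdeal (⟨{ξ}, hξcl⟩ : Closeds A.Z)) ξ = maximalIdeal (A.Z.presheaf.stalk ξ) :=
    stalkIdeal_vanishingIdeal_singleton hξcl
  by_cases h2 : 2 * E.b < d
  · -- a singular point over `ξ`: the chart origin
    obtain ⟨hreg, hdim, x, y, hxy, u, hu, hJ⟩ := hshape
    haveI := hreg
    obtain ⟨c, hc_def⟩ : ∃ c : Fin 2 → A.Z.presheaf.stalk ξ, c = ![x, y] := ⟨_, rfl⟩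
    have hc0 : c 0 = x := by rw [hc_def]; rfl
    have hc1 : c 1 = y := by rw [hc_def]; rfl
    have hc : Ideal.span (Set.range c) = maximalIdeal _ := by rw [hc_def, MohWindow.range_vec2]; exact hxy
    have hJc : stalkIdeal E.J ξ = Ideal.span {c 1 ^ E.b + u * c 0 ^ d} := by rw [hJ, hc0, hc1]
    obtain ⟨x', hπx, hle⟩ := MohWindow.exists_le_idealOrder_controlledTransform_of_le hπ hE.2 h2.le hdim c hc hY hJc
    have hshape0 : CuspShape E.b d (A.Z.presheaf.stalk (π x')) (stalkIdeal E.J (π x')) := by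
      rw [hπx]; exact ⟨hreg, hdim, x, y, hxy, u, hu, hJ⟩
    have hY' : stalkIdeal (vanishingIdeal (⟨{ξ}, hξcl⟩ : Closeds A.Z)) (π x') =
        maximalIdeal (A.Z.presheaf.stalk (π x')) := by rw [hπx]; exact hY
    have hcl' : IsClosed ({π.base x'} : Set A.Z) := by
      have : π.base x' = ξ := hπx
      rw [this]; exact hξcl
    refine ⟨A', π, x', hhom, hπ, hperm, hstd,
      Cusp.isClosed_singleton_of_le hπ hE.2 hbd hcl' hY' hshape0 hle, fun _ => ?_⟩
    exact Cusp.cuspShape_transform_of_le hπ hE.2 hbd hY' hshape0 hle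
  · -- no successor needed: any closed point will do
    haveI := A'.irreducible
    obtain ⟨x', -, hx'⟩ := nonempty_inter_closedPoints (Set.univ_nonempty (α := A'.Z))
      isClosed_univ.isLocallyClosed
    exact ⟨A', π, x', hhom, hπ, hperm, hstd, hx', fun h => absurd h h2⟩

/-- **The sharp chain**, as ℕ-indexed families: from a standard state `(A₀, E₀)` (exponent `b = E₀.b`) with a closed cusp
point of exponents `(b, d₀)` there are ambient data `𝒜 k`, ideal exponents `ℰ k`, closed points `Ξ k`,
exponents `δ k` and maps `ϖ k : 𝒜 (k+1) ⟶ 𝒜 k` with `(𝒜 0, ℰ 0) = (A₀, E₀)`, `δ 0 = d₀`, every `ℰ k` standard of exponent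
`b`, `Ξ k` a cusp point of exponents `(b, δ k)` whenever `b < δ k`, and — whenever `b < δ k` — step `k` is the
§2.1-permissible blow-up of `Ξ k` with `ℰ (k+1)` the transform and `δ (k+1) = δ k − b` (`exists_successor` iterated by
`Nat.rec` / `Classical.choose`; inert padding afterwards). [folklore] -/
theorem exists_chain (A₀ : AmbientDatum p K) (E₀ : IdealExponent A₀.Z) (hE₀ : E₀.IsStandard) {ξ₀ : A₀.Z}
    (hξ₀ : IsClosed ({ξ₀} : Set A₀.Z)) {d₀ : ℕ}
    (hshape₀ : E₀.b < d₀ → CuspShape E₀.b d₀ (A₀.Z.presheaf.stalk ξ₀) (stalkIdeal E₀.J ξ₀)) :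
    ∃ (𝒜 : ℕ → AmbientDatum p K) (ℰ : ∀ k, IdealExponent (𝒜 k).Z) (Ξ : ∀ k, (𝒜 k).Z) (δ : ℕ → ℕ)
      (ϖ : ∀ k, (𝒜 (k + 1)).Z ⟶ (𝒜 k).Z) (hcl : ∀ k, IsClosed ({Ξ k} : Set (𝒜 k).Z)),
      (⟨𝒜 0, ℰ 0⟩ : Σ A : AmbientDatum p K, IdealExponent A.Z) = ⟨A₀, E₀⟩ ∧ δ 0 = d₀ ∧
      (∀ k, (ℰ k).IsStandard) ∧ (∀ k, (ℰ k).b = E₀.b) ∧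
      (∀ k, E₀.b < δ k → CuspShape E₀.b (δ k) ((𝒜 k).Z.presheaf.stalk (Ξ k)) (stalkIdeal (ℰ k).J (Ξ k))) ∧
      (∀ k, E₀.b < δ k →
        (𝒜 (k + 1)).hom = ϖ k ≫ (𝒜 k).hom ∧ IsBlowup (ϖ k) (vanishingIdeal (⟨{Ξ k}, hcl k⟩ : Closeds (𝒜 k).Z)) ∧
        (ℰ k).IsPermissibleCentre (𝒜 k).hom ⟨{Ξ k}, hcl k⟩ ∧
        ℰ (k + 1) = (ℰ k).transform (ϖ k) ⟨{Ξ k}, hcl k⟩ ∧ δ (k + 1) = δ k - E₀.b) := by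
  classical
  -- one step, projection-free (genuine blow-up while `b < d`, inert padding afterwards)
  have hnext : ∀ (A : AmbientDatum p K) (E : IdealExponent A.Z) (ξ : A.Z) (d : ℕ), E.IsStandard → E.b = E₀.b →
      ∀ hcl : IsClosed ({ξ} : Set A.Z),
      (E₀.b < d → CuspShape E₀.b d (A.Z.presheaf.stalk ξ) (stalkIdeal E.J ξ)) →
      ∃ (A' : AmbientDatum p K) (π : A'.Z ⟶ A.Z) (E' : IdealExponent A'.Z) (ξ' : A'.Z) (d' : ℕ),
        E'.IsStandard ∧ E'.b = E₀.b ∧ IsClosed ({ξ'} : Set A'.Z) ∧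
        (E₀.b < d' → CuspShape E₀.b d' (A'.Z.presheaf.stalk ξ') (stalkIdeal E'.J ξ')) ∧
        (E₀.b < d → A'.hom = π ≫ A.hom ∧ IsBlowup π (vanishingIdeal (⟨{ξ}, hcl⟩ : Closeds A.Z)) ∧
          E.IsPermissibleCentre A.hom ⟨{ξ}, hcl⟩ ∧ E' = E.transform π ⟨{ξ}, hcl⟩ ∧ d' = d - E₀.b) := by
    intro A E ξ d hE hEb hcl hsh
    by_cases hlt : E₀.b < d
    · have hbd : E.b < d := hEb ▸ hlt
      have hsh' : CuspShape E.b d (A.Z.presheaf.stalk ξ) (stalkIdeal E.J ξ) := hEb ▸ hsh hlt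
      obtain ⟨A', π, ξ', hhom, hπ, hperm, hstd, hcl', hsh2⟩ := exists_successor A E hE hcl hbd hsh'
      refine ⟨A', π, E.transform π ⟨{ξ}, hcl⟩, ξ', d - E₀.b, hstd, hEb, hcl', fun h => ?_,
        fun _ => ⟨hhom, hπ, hperm, rfl, rfl⟩⟩
      have h2 : 2 * E.b < d := by rw [hEb]; omega
      have := hsh2 h2
      rwa [hEb] at this
    · exact ⟨A, 𝟙 _, E, ξ, d, hE, hEb, hcl, hsh, fun h => absurd h hlt⟩
  choose fA fπ fE fξ fd hstd' hb' hcl' hsh' hstep using hnext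
  -- the recursion
  let T : Type (u + 1) := Σ' (A : AmbientDatum p K) (E : IdealExponent A.Z) (ξ : A.Z) (d : ℕ),
    E.IsStandard ∧ E.b = E₀.b ∧ IsClosed ({ξ} : Set A.Z) ∧
      (E₀.b < d → CuspShape E₀.b d (A.Z.presheaf.stalk ξ) (stalkIdeal E.J ξ))
  let S₀ : T := ⟨A₀, E₀, ξ₀, d₀, hE₀, rfl, hξ₀, hshape₀⟩
  let nxt : T → T := fun S =>
    ⟨fA S.1 S.2.1 S.2.2.1 S.2.2.2.1 S.2.2.2.2.1 S.2.2.2.2.2.1 S.2.2.2.2.2.2.1 S.2.2.2.2.2.2.2, fE S.1 S.2.1 S.2.2.1 S.2.2.2.1 S.2.2.2.2.1 S.2.2.2.2.2.1 S.2.2.2.2.2.2.1 S.2.2.2.2.2.2.2, fξ S.1 S.2.1 S.2.2.1 S.2.2.2.1 S.2.2.2.2.1 S.2.2.2.2.2.1 S.2.2.2.2.2.2.1 S.2.2.2.2.2.2.2, fd S.1 S.2.1 S.2.2.1 S.2.2.2.1 S.2.2.2.2.1 S.2.2.2.2.2.1 S.2.2.2.2.2.2.1 S.2.2.2.2.2.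2.2,
      hstd' S.1 S.2.1 S.2.2.1 S.2.2.2.1 S.2.2.2.2.1 S.2.2.2.2.2.1 S.2.2.2.2.2.2.1 S.2.2.2.2.2.2.2, hb' S.1 S.2.1 S.2.2.1 S.2.2.2.1 S.2.2.2.2.1 S.2.2.2.2.2.1 S.2.2.2.2.2.2.1 S.2.2.2.2.2.2.2, hcl' S.1 S.2.1 S.2.2.1 S.2.2.2.1 S.2.2.2.2.1 S.2.2.2.2.2.1 S.2.2.2.2.2.2.1 S.2.2.2.2.2.2.2, hsh' S.1 S.2.1 S.2.2.1 S.2.2.2.1 S.2.2.2.2.1 S.2.2.2.2.2.1 S.2.2.2.2.2.2.1 S.2.2.2.2.2.2.2⟩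
  let seq : ℕ → T := fun k => Nat.rec S₀ (fun _ S => nxt S) k
  refine ⟨fun k => (seq k).1, fun k => (seq k).2.1, fun k => (seq k).2.2.1, fun k => (seq k).2.2.2.1,
    fun k => fπ (seq k).1 (seq k).2.1 (seq k).2.2.1 (seq k).2.2.2.1 (seq k).2.2.2.2.1 (seq k).2.2.2.2.2.1 (seq k).2.2.2.2.2.2.1 (seq k).2.2.2.2.2.2.2,
    fun k => (seq k).2.2.2.2.2.2.1, rfl, rfl, fun k => (seq k).2.2.2.2.1, fun k => (seq k).2.2.2.2.2.1,
    fun k hk => (seq k).2.2.2.2.2.2.2 hk, fun k hk => ?_⟩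
  exact hstep (seq k).1 (seq k).2.1 (seq k).2.2.1 (seq k).2.2.2.1 (seq k).2.2.2.2.1 (seq k).2.2.2.2.2.1 (seq k).2.2.2.2.2.2.1 (seq k).2.2.2.2.2.2.2 hk

/-- [OURS · L1 W4.6 rung (iii); NOT a statement of the manuscript] **A finite §2.1-permissible sequence of every length
`L` with `L·b < d`** starts at any standard state over a perfect field carrying a closed cusp point of exponents `(b, d)`
(`b = E.b`; `b ∣ d` allowed — then the germ is a `b`-th power and `Sing(E)` a curve, and the chain still exists): the first
`L` blow-ups of the sharp chain (`exists_chain`), whose exponents `d, d − b, …, d − (L−1)b` all exceed `b`. [folklore] -/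
theorem exists_finPermissibleRun_of_cuspShape (A : AmbientDatum p K) (E : IdealExponent A.Z) (hE : E.IsStandard)
    {ξ : A.Z} (hξcl : IsClosed ({ξ} : Set A.Z)) {d : ℕ}
    (hshape : E.b < d → CuspShape E.b d (A.Z.presheaf.stalk ξ) (stalkIdeal E.J ξ)) {L : ℕ} (hL : L * E.b < d) :
    ∃ r : FinPermissibleRun p K, r.len = L ∧ (⟨r.A 0, r.E 0⟩ : Σ A : AmbientDatum p K, IdealExponent A.Z) = ⟨A, E⟩ := by
  obtain ⟨𝒜, ℰ, Ξ, δ, ϖ, hcl, h0, hδ0, hstd, hb, hsh, hstep⟩ := exists_chain A E hE hξcl hshape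
  have hbpos : 0 < E.b := hE.2
  -- the exponents along the first `L` stages
  have hδ : ∀ k, k ≤ L → δ k = d - k * E.b := by
    intro k
    induction k with
    | zero => intro _; simp [hδ0]
    | succ k ih =>
      intro hk
      have hk' := ih (Nat.le_of_succ_le hk)
      have hlt : E.b < δ k := by
        rw [hk']
        have : (k + 1) * E.b ≤ L * E.b := Nat.mul_le_mul_right _ hk
        rw [Nat.succ_mul] at this
        omega
      rw [(hstep k hlt).2.2.2.2, hk', Nat.succ_mul]
      omega
  have hlt : ∀ k, k < L → E.b < δ k := by
    intro k hk
    rw [hδ k hk.le]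
    have : (k + 1) * E.b ≤ L * E.b := Nat.mul_le_mul_right _ hk
    rw [Nat.succ_mul] at this
    omega
  exact ⟨⟨L, 𝒜, ℰ, fun k => ⟨{Ξ k}, hcl k⟩, ϖ, fun k _ => hstd k, fun k hk => (hstep k (hlt k hk)).2.2.1,
    fun k hk => (hstep k (hlt k hk)).1, fun k hk => (hstep k (hlt k hk)).2.1,
    fun k hk => (hstep k (hlt k hk)).2.2.2.1⟩, rfl, h0⟩

end Existence

end Cusp

/-! ## K4.6's family: the maximal length is exactly `⌊n/p⌋` -/

namespace CuspPlane

open MvPolynomial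
open Literature.AlgebraicGeometry.Hironaka2017.SpecOrders
open Literature.AlgebraicGeometry.Hironaka2017.S16Proof

variable (p : ℕ) [Fact p.Prime] (K : Type u) [Field K] [CharP K p] [PerfectField K]

/-- [OURS · L1 W4.6 rung (iii); NOT a statement of the manuscript] **The bound `⌊n/p⌋` is attained**: for every prime `p`,
every PERFECT field `K` of characteristic `p` and `p < n`, `p ∤ n`, there is a finite §2.1-permissible blow-up sequence of
length EXACTLY `n/p` starting at K4.6's state `(𝔸²_K, E_n = ((y^p + xⁿ)·𝒪, p))` (pv-13: the origin is its closed singular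
point, with the cusp presentation `y^p + 1·xⁿ`, `CuspPlane.cuspShape_ξ`, `isStandard`; then
`Cusp.exists_finPermissibleRun_of_cuspShape` with `L = n/p`, as `(n/p)·p < n` for `p ∤ n`). [folklore] -/
theorem exists_finPermissibleRun_len_eq {n : ℕ} (hpn : p < n) (hn : ¬ p ∣ n) :
    ∃ r : FinPermissibleRun p K, r.len = n / p ∧
      (⟨r.A 0, r.E 0⟩ : Σ A : AmbientDatum p K, IdealExponent A.Z) =
        ⟨U82Gap.amb p K, ⟨shf (MvPolynomial (Fin 2) K) (Ideal.span {X 1 ^ p + X 0 ^ n}), p⟩⟩ := by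
  have hp : 0 < p := (Fact.out : p.Prime).pos
  have hL : n / p * p < n := by
    rcases (Nat.div_mul_le_self n p).lt_or_eq with h | h
    · exact h
    · exact absurd (Dvd.intro_left _ h) hn
  exact Cusp.exists_finPermissibleRun_of_cuspShape (U82Gap.amb p K)
    ⟨shf (MvPolynomial (Fin 2) K) (Ideal.span {X 1 ^ p + X 0 ^ n}), p⟩
    (isStandard p K (Nat.lt_of_le_of_lt (Nat.zero_le p) hpn))
    (U82Gap.ξ_mem_closedPoints K) (fun _ => cuspShape_ξ p K n) hL

/-- [OURS · L1 W4.6 rung (iii); NOT a statement of the manuscript] **THE MAXIMAL LENGTH of a §2.1-permissible blow-up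
sequence from K4.6's state `(𝔸²_K, ((y^p + xⁿ)·𝒪, p))` is EXACTLY `⌊n/p⌋`** (`p` prime, `K` perfect of characteristic `p`,
`p < n`, `p ∤ n`): some sequence has length `n/p` (`exists_finPermissibleRun_len_eq`) and none is longer
(`finPermissibleRun_len_le`, file XI, any field). The length column of the K4.6 table, résumé-free and notion-free.
[folklore] -/
theorem finPermissibleRun_maxLen {n : ℕ} (hpn : p < n) (hn : ¬ p ∣ n) :
    (∃ r : FinPermissibleRun p K, r.len = n / p ∧
      (⟨r.A 0, r.E 0⟩ : Σ A : AmbientDatum p K, IdealExponent A.Z) =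
        ⟨U82Gap.amb p K, ⟨shf (MvPolynomial (Fin 2) K) (Ideal.span {X 1 ^ p + X 0 ^ n}), p⟩⟩) ∧
    ∀ r : FinPermissibleRun p K,
      (⟨r.A 0, r.E 0⟩ : Σ A : AmbientDatum p K, IdealExponent A.Z) =
        ⟨U82Gap.amb p K, ⟨shf (MvPolynomial (Fin 2) K) (Ideal.span {X 1 ^ p + X 0 ^ n}), p⟩⟩ → r.len ≤ n / p :=
  ⟨exists_finPermissibleRun_len_eq p K hpn hn, fun r hr => finPermissibleRun_len_le p K hpn hn r hr⟩

end CuspPlane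

end CampaignW46

end Summit.ResolutionOfSingularities.ResolutionOfSingularities.Theorems

end
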